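import Summits.AtomisticToContinuum.BoseEinsteinCondensation.Theses.BECNudgeWalk
import Summits.AtomisticToContinuum.BoseEinsteinCondensation.Theorems.BECNudgeWalkNudgedCondensationStubLowerBoundTL
import Summits.AtomisticToContinuum.BoseEinsteinCondensation.Theorems.BECNudgeWalkNudgedCondensationStubCondensedTrial

/-!
# Route `BECNudgeWalk`, crux `NudgedCondensation` (stmt-AtomisticToContinuum-14362) — settled

The RUNG of the nudge walk: for every repulsive finite-range `v` and all `τ, θ > 0`, at small
density and for all large `N` (`L = (N/ρ)^{1/3}`, `s = θρa`, `a = (scatteringLength v).toReal`)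

  `R(s) := inf_Ψ (⟨Ψ,HΨ⟩ + s·(N − n₀(Ψ))) ≤ E₀^D(N,L) + s·τ·N`.

This is the sorry-free form of the registered skeleton `Cruxes/NudgedCondensation/Lines/birth.lean`
(line `registered`), whose two stubs have landed:

* `stub_lowerBoundTL` (`Theorems/BECNudgeWalkNudgedCondensationStubLowerBoundTL.lean`) — the
  Lieb–Yngvason lower bound in thermodynamic-limit form, `E₀^D(N, (N/ρ)^{1/3}) ≥ 4πρa(1−η)N` for
  `ρ < ρ₀(v,η)` and all large `N` [LSSY2005, Thm. 2.4 (2.35)];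
* `stub_condensedTrial` (`Theorems/BECNudgeWalkNudgedCondensationStubCondensedTrial.lean`) — the
  condensed Dirichlet trial state: for `a > 0`, energy `≤ 4πρa(1+η)N` and flat-mode occupation
  `≥ (1−η)N` (Basti–Cenatiempo–Schlein cut-off of the periodic Jastrow–Dyson condensed state).

`NudgedCondensation_of_stubs : StubA → StubB → NudgedCondensation` is the kernel-checked assembly of
the skeleton (verbatim): for `a = 0` the nudge vanishes (`s = 0`) and `R(0) = E₀^D`; for `a > 0`
evaluate the nudged functional at the stub's trial state with `η = min(1/2, θτ/(8π+θ))`: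
`R(s) ≤ 4πρa(1+η)N + s·ηN ≤ 4πρa(1−η)N + sτN ≤ E₀^D + sτN` because `η(8π + θ) ≤ θτ` — all in
`ℝ≥0∞` with the truncated subtraction `N − n₀(Ψ) ≤ ηN`.  `NudgedCondensation_of` composes it with the
two stubs BY NAME and is the closing theorem of the item.

References: LSSY 2005 (arXiv:cond-mat/0610117) Thms. 2.2, 2.4; Dyson 1957; Lieb–Yngvason 1998;
Basti–Cenatiempo–Schlein 2021 App. A; Lauwers–Verbeure–Zagrebnov 2003 (gap-assisted BEC).
-/

namespace Summit.AtomisticToContinuum.BoseEinsteinCondensation.NudgedCondensationLine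

open Literature.MathematicalPhysics.QuantumManyBody.BoseGas
open Summit.AtomisticToContinuum.BoseEinsteinCondensation.Theses.BECNudgeWalk (NudgedCondensation)

/-- **Assembly, implication form (kernel-checked, axioms `propext`/`Classical.choice`/`Quot.sound`
only).** Stub A → Stub B → the crux `NudgedCondensation` BY NAME. -/
theorem NudgedCondensation_of_stubs :
    (∀ v : ℝ → ENNReal, IsRepulsiveFiniteRange v → scatteringLength v ≠ ⊤ →
      ∀ η : ℝ, 0 < η → ∃ ρ₀ : ℝ, 0 < ρ₀ ∧ ∀ ρ : ℝ, 0 < ρ → ρ < ρ₀ →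
        ∀ᶠ N : ℕ in Filter.atTop,
          ENNReal.ofReal (4 * Real.pi * ρ * (scatteringLength v).toReal * (1 - η) * N) ≤
            groundStateEnergy v N (sideLength ρ N)) →
    (∀ v : ℝ → ENNReal, IsRepulsiveFiniteRange v → 0 < (scatteringLength v).toReal →
      ∀ η : ℝ, 0 < η → ∃ ρ₀ : ℝ, 0 < ρ₀ ∧ ∀ ρ : ℝ, 0 < ρ → ρ < ρ₀ →
        ∀ᶠ N : ℕ in Filter.atTop,
          ∃ Ψ : TrialState N (sideLength ρ N),
            energy v Ψ ≤
                ENNReal.ofReal (4 * Real.pi * ρ * (scatteringLength v).toReal * (1 + η) * N) ∧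
              ENNReal.ofReal ((1 - η) * N) ≤
                occupation N (constantMode (sideLength ρ N)) Ψ.ψ) →
    NudgedCondensation := by
  intro hA hB v hv τ θ hτ hθ
  rcases (ENNReal.toReal_nonneg : 0 ≤ (scatteringLength v).toReal).eq_or_lt with ha | ha
  · -- `a = 0`: the nudge `s = θρa` vanishes and `R(0) = E₀^D` by definition of the ground-state energy.
    refine ⟨1, one_pos, fun ρ _ _ => Filter.Eventually.of_forall fun N => ?_⟩
    simp [← ha, groundStateEnergy]
  · -- `a > 0`: evaluate the nudged functional at the condensed trial state of Stub B.
    have hatop : scatteringLength v ≠ ⊤ := (ENNReal.toReal_pos_iff.mp ha).2.ne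
    have h8 : 0 < 8 * Real.pi + θ := by positivity
    -- the tolerance `η = min (1/2) (θτ/(8π+θ))`
    obtain ⟨η, hη, hη1, hη2⟩ : ∃ η : ℝ, 0 < η ∧ η ≤ 1 / 2 ∧ η * (8 * Real.pi + θ) ≤ θ * τ := by
      refine ⟨min (1 / 2) (θ * τ / (8 * Real.pi + θ)), lt_min (by norm_num) (by positivity),
        min_le_left _ _, ?_⟩
      calc min (1 / 2) (θ * τ / (8 * Real.pi + θ)) * (8 * Real.pi + θ)
          ≤ θ * τ / (8 * Real.pi + θ) * (8 * Real.pi + θ) :=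
            mul_le_mul_of_nonneg_right (min_le_right _ _) h8.le
        _ = θ * τ := div_mul_cancel₀ _ h8.ne'
    obtain ⟨ρ₁, hρ₁, H1⟩ := hA v hv hatop η hη
    obtain ⟨ρ₂, hρ₂, H2⟩ := hB v hv ha η hη
    refine ⟨min ρ₁ ρ₂, lt_min hρ₁ hρ₂, fun ρ hρ hρlt => ?_⟩
    filter_upwards [H1 ρ hρ (hρlt.trans_le (min_le_left _ _)),
      H2 ρ hρ (hρlt.trans_le (min_le_right _ _))] with N hlow hΨ
    obtain ⟨Ψ, hE, hocc⟩ := hΨ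
    dsimp only
    set a : ℝ := (scatteringLength v).toReal with ha_def
    -- depletion of the trial state in the flat mode: `N − n₀(Ψ) ≤ ηN` (truncated subtraction)
    have hdep : (N : ENNReal) - occupation N (constantMode (sideLength ρ N)) Ψ.ψ ≤
        ENNReal.ofReal (η * N) := by
      refine tsub_le_iff_right.mpr ?_
      calc (N : ENNReal) = ENNReal.ofReal (η * N + (1 - η) * N) := by
            rw [← ENNReal.ofReal_natCast]; congr 1; ring
        _ ≤ ENNReal.ofReal (η * N) + ENNReal.ofReal ((1 - η) * N) := ENNReal.ofReal_add_le
        _ ≤ ENNReal.ofReal (η * N) + occupation N (constantMode (sideLength ρ N)) Ψ.ψ :=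
            add_le_add le_rfl hocc
    have hs : 0 ≤ θ * ρ * a := by positivity
    have h1η : 0 ≤ 1 - η := by linarith
    have hlow' : 0 ≤ 4 * Real.pi * ρ * a * (1 - η) * N :=
      mul_nonneg (mul_nonneg (by positivity) h1η) (Nat.cast_nonneg N)
    -- the real-number budget: `4πρa(1+η)N + s·ηN ≤ 4πρa(1−η)N + s·τ·N` since `η(8π+θ) ≤ θτ`
    have hreal : 4 * Real.pi * ρ * a * (1 + η) * N + θ * ρ * a * (η * N) ≤
        4 * Real.pi * ρ * a * (1 - η) * N + θ * ρ * a * τ * N := by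
      have key : 0 ≤ ρ * a * N * (θ * τ - η * (8 * Real.pi + θ)) :=
        mul_nonneg (by positivity) (sub_nonneg.mpr hη2)
      have expand : (4 * Real.pi * ρ * a * (1 - η) * N + θ * ρ * a * τ * N) -
          (4 * Real.pi * ρ * a * (1 + η) * N + θ * ρ * a * (η * N)) =
          ρ * a * N * (θ * τ - η * (8 * Real.pi + θ)) := by ring
      rw [← expand] at key
      exact sub_nonneg.mp key
    calc (⨅ Φ : TrialState N (sideLength ρ N), (energy v Φ + ENNReal.ofReal (θ * ρ * a) *
            ((N : ENNReal) - occupation N (constantMode (sideLength ρ N)) Φ.ψ)))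
        ≤ energy v Ψ + ENNReal.ofReal (θ * ρ * a) *
            ((N : ENNReal) - occupation N (constantMode (sideLength ρ N)) Ψ.ψ) :=
          iInf_le _ Ψ
      _ ≤ ENNReal.ofReal (4 * Real.pi * ρ * a * (1 + η) * N) +
            ENNReal.ofReal (θ * ρ * a) * ENNReal.ofReal (η * N) :=
          add_le_add hE (by gcongr)
      _ = ENNReal.ofReal (4 * Real.pi * ρ * a * (1 + η) * N + θ * ρ * a * (η * N)) := by
          rw [← ENNReal.ofReal_mul hs, ← ENNReal.ofReal_add (by positivity) (by positivity)]
      _ ≤ ENNReal.ofReal (4 * Real.pi * ρ * a * (1 - η) * N + θ * ρ * a * τ * N) :=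
          ENNReal.ofReal_le_ofReal hreal
      _ = ENNReal.ofReal (4 * Real.pi * ρ * a * (1 - η) * N) + ENNReal.ofReal (θ * ρ * a * τ * N) :=
          ENNReal.ofReal_add hlow' (by positivity)
      _ ≤ groundStateEnergy v N (sideLength ρ N) + ENNReal.ofReal (θ * ρ * a * τ * N) :=
          add_le_add hlow le_rfl

/-- **`NudgedCondensation` holds** (settles stmt-AtomisticToContinuum-14362, exact route decl):
the crux BY NAME from the two landed stubs BY NAME (`stub_lowerBoundTL`, `stub_condensedTrial`)
through the kernel-checked assembly `NudgedCondensation_of_stubs`.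
[cite: LSSY2005, Thm. 2.4 (2.35)] -/
theorem NudgedCondensation_of : NudgedCondensation :=
  NudgedCondensation_of_stubs stub_lowerBoundTL stub_condensedTrial

end Summit.AtomisticToContinuum.BoseEinsteinCondensation.NudgedCondensationLine
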